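import Summits.SmoothPoincare4.SmoothPoincare4.Theses.ConvexBisection
import Literature.Topology.FourManifolds.Gluing
import Literature.Topology.FourManifolds.GluingIsotopyProofs
import Literature.Topology.FourManifolds.Isotopy
import Literature.Topology.FourManifolds.ClosedBallProofs

/-!
# Stub `stub_isotopyRegluing` of line `modp-braid-orbits` (reshape r5) for crux
`ConvexBisection.AcyclicBisectionExists` (item stmt-SmoothPoincare4-10508, route route-SmoothPoincare4-ConvexBisection)

RE-GLUING ALONG AN ISOTOPIC IDENTIFICATION.  If the smooth 4-manifold `M` is the boundary gluing
`M = W₁ ∪_φ W₂` (`Literature.Topology.FourManifolds.IsBoundaryGluing b₁ b₂ φ (𝓡 4) M`) of two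
compact smooth 4-manifolds with boundary along a diffeomorphism `φ : ∂W₁ ≅ ∂W₂` of boundary data,
and `φ₀ ∈ Diff ∂W₁` is isotopic to the identity
(`Literature.Topology.FourManifolds.Diffeomorph.IsIsotopic φ₀ (Diffeomorph.refl _ _ _)`), then `M`
is also the gluing `W₁ ∪_{φ₀ ≫ φ} W₂` along `φ₀.trans φ = φ ∘ φ₀`.  This is Hirsch, *Differential
Topology* (1976), Ch. 8 §2, Thm. 2.3 in the relational form of the tree.

This is the registered stub `stub_isotopyRegluing` of the checked skeleton
`Cruxes/AcyclicBisectionExists/Lines/modp-braid-orbits.lean` (lead reshape r5): the step between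
Giroux–Gray (which produces `φ₀`) and the packaging of the re-glued pieces.  Proof: post-compose
a smooth isotopy `φ₀ ≃ id` stagewise with the diffeomorphism `φ` (stages `φ ∘ F_t` are smooth
embeddings by the tree's `Manifold.IsSmoothEmbedding.diffeomorph_comp`, `ClosedBallProofs.lean`),
giving `IsSmoothlyIsotopic (𝓡 3) (𝓡 3) ⇑(φ₀.trans φ) ⇑φ`, and apply the tree's PROVED
`Literature.Topology.FourManifolds.IsBoundaryGluing.of_isSmoothlyIsotopic`
(`GluingIsotopyProofs.lean`); the Hausdorff property of `W₂` needed there is inherited from `M`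
through the smooth embedding `W₂ ↪ M` of the gluing.
-/

noncomputable section

-- the prescribed namespace `Summit.<P>.<Sub>.…` duplicates `SmoothPoincare4` (P = Sub)
set_option linter.dupNamespace false

open scoped Manifold ContDiff Topology ContinuousMap

namespace Summit.SmoothPoincare4.SmoothPoincare4.Theorems.AcyclicBisectionExists.ModpBraidOrbits

open Literature.Topology.FourManifolds (BoundaryData IsBoundaryGluing)

/-- **Post-composing a smooth isotopy with a diffeomorphism.** If `F_t` is a smooth isotopy from
`f` to `g` (maps `X → Y`) and `φ : Y ≅ Y'` is a diffeomorphism (same model), then `t ↦ φ ∘ F_t`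
is a smooth isotopy from `φ ∘ f` to `φ ∘ g`: joint smoothness by composition, and every stage is
a smooth embedding by `Manifold.IsSmoothEmbedding.diffeomorph_comp`. Hirsch, *Differential
Topology* (1976), Ch. 8 §1. [folklore] -/
theorem isSmoothlyIsotopic_diffeomorph_comp {EM HM EN HN : Type*} [NormedAddCommGroup EM]
    [NormedSpace ℝ EM] [TopologicalSpace HM] {I : ModelWithCorners ℝ EM HM}
    [NormedAddCommGroup EN] [NormedSpace ℝ EN] [TopologicalSpace HN]
    {J : ModelWithCorners ℝ EN HN} {X : Type*} [TopologicalSpace X] [ChartedSpace HM X]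
    {Y Y' : Type*} [TopologicalSpace Y] [ChartedSpace HN Y] [IsManifold J ∞ Y]
    [TopologicalSpace Y'] [ChartedSpace HN Y'] [IsManifold J ∞ Y'] {f g : X → Y}
    (h : Literature.Topology.FourManifolds.IsSmoothlyIsotopic I J f g) (φ : Y ≃ₘ⟮J, J⟯ Y') :
    Literature.Topology.FourManifolds.IsSmoothlyIsotopic I J (φ ∘ f) (φ ∘ g) := by
  obtain ⟨F⟩ := h
  exact ⟨{ toFun := fun t => φ ∘ F.toFun t
           contMDiff := φ.contMDiff.comp F.contMDiff
           isSmoothEmbedding := fun t => (F.isSmoothEmbedding t).diffeomorph_comp φ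
           map_zero := by rw [F.map_zero]
           map_one := by rw [F.map_one] }⟩

/-- **Stub `stub_isotopyRegluing` (re-gluing along an isotopic identification).** If
`M = W₁ ∪_φ W₂` is the boundary gluing of two compact smooth 4-manifolds with boundary along
`φ : ∂W₁ ≅ ∂W₂` and the self-diffeomorphism `φ₀` of `∂W₁` is isotopic to the identity, then also
`M = W₁ ∪_{φ₀ ≫ φ} W₂`: the post-composed isotopy `φ ∘ φ₀ ≃ φ ∘ id = φ`
(`isSmoothlyIsotopic_diffeomorph_comp`) and the tree's
`Literature.Topology.FourManifolds.IsBoundaryGluing.of_isSmoothlyIsotopic` (Hirsch (1976), Ch. 8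
§2, Thm. 2.3, relational form), `W₂` being Hausdorff as a subspace of `M` through the embedding
of the gluing. [folklore] -/
theorem stub_isotopyRegluing :
    ∀ (M : Type) [TopologicalSpace M] [T2Space M] [SecondCountableTopology M]
      [ChartedSpace (EuclideanSpace ℝ (Fin 4)) M] [IsManifold (𝓡 4) ∞ M]
      (W₁ : Type) [TopologicalSpace W₁] [ChartedSpace (EuclideanHalfSpace 4) W₁]
        [IsManifold (𝓡∂ 4) ∞ W₁] [CompactSpace W₁]
      (W₂ : Type) [TopologicalSpace W₂] [ChartedSpace (EuclideanHalfSpace 4) W₂]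
        [IsManifold (𝓡∂ 4) ∞ W₂] [CompactSpace W₂]
      (b₁ : BoundaryData (𝓡∂ 4) W₁ (𝓡 3)) (b₂ : BoundaryData (𝓡∂ 4) W₂ (𝓡 3))
      (φ : b₁.carrier ≃ₘ⟮𝓡 3, 𝓡 3⟯ b₂.carrier) (φ₀ : b₁.carrier ≃ₘ⟮𝓡 3, 𝓡 3⟯ b₁.carrier),
      IsBoundaryGluing b₁ b₂ φ (𝓡 4) M →
      Literature.Topology.FourManifolds.Diffeomorph.IsIsotopic φ₀ (Diffeomorph.refl (𝓡 3) b₁.carrier ∞) →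
      IsBoundaryGluing b₁ b₂ (φ₀.trans φ) (𝓡 4) M := by
  intro M _ _ _ _ _ W₁ _ _ _ _ W₂ _ _ _ _ b₁ b₂ φ φ₀ hglue hiso
  -- `W₂` is Hausdorff: it embeds into the Hausdorff `M` through the gluing
  haveI : T2Space W₂ := by
    obtain ⟨_, jB, _, hB, _, _⟩ := hglue.isClosedGluing
    exact hB.isEmbedding.t2Space
  -- the isotopy `φ ∘ φ₀ ≃ φ ∘ id = φ`, i.e. from `φ₀.trans φ` to `φ`
  have h : Literature.Topology.FourManifolds.IsSmoothlyIsotopic (𝓡 3) (𝓡 3) ⇑(φ₀.trans φ) ⇑φ := by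
    have h' := isSmoothlyIsotopic_diffeomorph_comp hiso φ
    rwa [Diffeomorph.coe_refl, Function.comp_id, ← Diffeomorph.coe_trans] at h'
  exact Literature.Topology.FourManifolds.IsBoundaryGluing.of_isSmoothlyIsotopic h hglue

end Summit.SmoothPoincare4.SmoothPoincare4.Theorems.AcyclicBisectionExists.ModpBraidOrbits

end
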